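import Summits.ValiantsHypothesis.ValiantsHypothesis.Theorems.GrenetZeonDualUnipotentThreeHalvesHeavyTopHalfSpeedBudget
import Summits.ValiantsHypothesis.ValiantsHypothesis.Theorems.GrenetZeonDualUnipotentThreeHalvesWordFlagPencil

/-!
# «Ratio-speed» — the FREE-RATIO word certificate and the residual uniform law `DenseRatioLaw`
# (val-idea-30 g2, round 2 of card `half-speed-tradeoff`; crux `GrenetZeon.DualUnipotentThreeHalves` = stmt-ValiantsHypothesis-24318,
# residue R2 `HeavyTopLaw`)

WHY THIS FILE.  LINE β's laws `HalfSpeedLaw` (S⁺) and `HalfSpeedIrrLaw` (C⁺, the registered research stub) are FALSE (this seat,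
`InflatedReturns.lean`: the inflated MOR plane `U₄ₖ = J₄ ⊗ M_k ⊕ ℂ(E₃₁−E₄₂) ⊗ 1_k` forces drop/climb RATIO 2, while the half-speed
profile fixes ratio 1).  The ratio must be a free parameter of the certificate.  This file types the free-ratio currency
`RatioSpeed ρ Θ U T` («every non-zero word has `#Q ≤ Θ + ρ·#P`»; `ρ = 1` is `HalfSpeed`), proves the level-function ⇒ word
lemma for general ratio (`ratioSpeed_of_shifts`: one integer level function along which `U` drops `≤ ρ` levels and `T` climbs),
the word-tame / word-cheap conversions with budget `⌊(Θ + ρ(n−1))/(1+ρ)⌋`, and the RESIDUAL UNIFORM LAW `DenseRatioLaw`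
(natural height `Θ = ⌊√D⌋/4`, density hypothesis `C·d² ≤ D·⌊√D⌋`, budget `4(ρ+1)·codim ≤ D`, `D = dim U`) — the only
normalisation of a format-free half-speed-type law that the inflation calculus of `HALFSPEED-DEAD.md` does not kill
(all-heights / `C·d²`-budget versions die on `U_{p,k} ⊕ 𝔫`, fixed-ratio versions on `U_{p,k}`).  HONEST LABEL: `DenseRatioLaw` is
R2-in-words made UNIFORM (one profile per `(U, T)` instead of one per pair) and re-parametrised by `(d, D)`; it carries NO inductive
structure (density is not inherited by constituents) — lens (e) «strengthen-to-induct» is exhausted at the format-free level.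
`sorry` only in the two stubs `stub_flagCostWordLaw_of_denseRatioLaw` (K0″, M: port of ✓ p661921 with `δ ↦ (ρ+1)δ`) and
`stub_denseRatioLaw` (LAW).  Nothing here proves R2 / 24318 / S3b; VP ≠ VNP is NOT proved.
-/

noncomputable section

-- single-conjunct layout: Sub = Summit, duplicated namespace component intended
set_option linter.dupNamespace false
set_option autoImplicit false
set_option linter.unusedSectionVars false

namespace Summit.ValiantsHypothesis.ValiantsHypothesis.Cruxes.DualUnipotentThreeHalves.RatioSpeed

open MvPolynomial Matrix
open scoped BigOperators
open Summit.ValiantsHypothesis.ValiantsHypothesis.Cruxes.TwoDimCoefficients.DimTwoCases (AffMat IsAffine)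
open Summit.ValiantsHypothesis.ValiantsHypothesis.Theorems.GrenetZeon.RadicalSplit
open Summit.ValiantsHypothesis.ValiantsHypothesis.Theorems.GrenetZeon.HalfSpeed

/-! ## §1 The free-ratio word certificate -/

section Basic

variable {ι : Type*} [Fintype ι] [DecidableEq ι]

/-- **Ratio-speed of ratio `ρ` and height `Θ`**: every NON-ZERO word in a letter `P ∈ U` and a letter `Q ∈ T` has
`#Q ≤ Θ + ρ·#P` (word-tame profile `(r, c, Θ) = (ρ, 1, Θ)`; `ρ = 1` is LINE β's `HalfSpeed`). -/
def RatioSpeed (ρ Θ : ℕ) (U T : Set (Matrix ι ι ℂ)) : Prop :=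
  ∀ P ∈ U, ∀ Q ∈ T, ∀ w : List Bool, gword P Q w ≠ 0 → w.count true ≤ Θ + ρ * w.count false

theorem ratioSpeed_one_iff (Θ : ℕ) (U T : Set (Matrix ι ι ℂ)) : RatioSpeed 1 Θ U T ↔ HalfSpeed Θ U T := by
  simp only [RatioSpeed, HalfSpeed, one_mul]

/-- Monotone in the ratio and the height. -/
theorem ratioSpeed_mono {ρ ρ' Θ Θ' : ℕ} (hρ : ρ ≤ ρ') (hΘ : Θ ≤ Θ') {U T : Set (Matrix ι ι ℂ)}
    (h : RatioSpeed ρ Θ U T) : RatioSpeed ρ' Θ' U T := fun P hP Q hQ w hw =>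
  (h P hP Q hQ w hw).trans (by have := Nat.mul_le_mul_right (w.count false) hρ; omega)

/-- Antitone in both spaces. -/
theorem ratioSpeed_anti {ρ Θ : ℕ} {U U' T T' : Set (Matrix ι ι ℂ)} (hU : U' ⊆ U) (hT : T' ⊆ T)
    (h : RatioSpeed ρ Θ U T) : RatioSpeed ρ Θ U' T' := fun P hP Q hQ w hw => h P (hU hP) Q (hT hQ) w hw

theorem ratioSpeed_of_halfSpeed {ρ Θ : ℕ} (hρ : 1 ≤ ρ) {U T : Set (Matrix ι ι ℂ)} (h : HalfSpeed Θ U T) :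
    RatioSpeed ρ Θ U T :=
  ratioSpeed_mono hρ le_rfl ((ratioSpeed_one_iff Θ U T).2 h)

end Basic

/-! ## §2 Ratio-speed ⇒ word-tame ⇒ word-cheap (budget `⌊(Θ + ρ(n−1))/(1+ρ)⌋`) -/

/-- **Ratio-speed ⇒ word-tame** with budget `⌊(Θ + ρ(n−1))/(1+ρ)⌋` (profile `(r, c) = (ρ, 1)`). -/
theorem wordTame_of_ratioSpeed {m : ℕ} (n ρ Θ : ℕ) (P Q : Matrix (Fin m) (Fin m) ℂ)
    (h : ∀ w : List Bool, word P Q w ≠ 0 → w.count true ≤ Θ + ρ * w.count false) :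
    WordTame n ((Θ + ρ * (n - 1)) / (1 + ρ)) P Q := by
  refine ⟨ρ, 1, Θ, le_rfl, le_rfl, fun w hw => ?_⟩
  rw [one_mul]
  exact h w hw

/-- **Ratio-speed certificate, `K` given ⇒ `WordCheap`.** -/
theorem wordCheap_of_ratioSpeed {n m : ℕ} (N : AffMat n m) (U T : Set (Matrix (Fin m) (Fin m) ℂ)) (ρ Θ : ℕ)
    (hRS : RatioSpeed ρ Θ U T) (hU : ∀ x : Fin n × Fin n → ℂ, N.map (MvPolynomial.eval x) ∈ U)
    (K : Submodule ℂ (Fin n × Fin n → ℂ)) (hK : ∀ v ∈ K, linPart N v ∈ T)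
    (hdim : ((Θ + ρ * (n - 1)) / (1 + ρ) + 1) * n < Module.finrank ℂ K) :
    WordCheap n m N := by
  refine ⟨K, (Θ + ρ * (n - 1)) / (1 + ρ), hdim, fun x v hv => ?_⟩
  exact wordTame_of_ratioSpeed n ρ Θ _ _ fun w hw => hRS _ (hU x) _ (hK v hv) w (by rwa [gword_eq_word])

/-! ## §3 One level function ⇒ ratio-speed (the weight certificate in word currency, general ratio) -/

section Shifts

variable {ι : Type*} [Fintype ι] [DecidableEq ι]

/-- `X` shifts the integer level function `lvl` by at least `s`: every non-zero entry `X i j` has `lvl j + s ≤ lvl i`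
(`s = 1`: climbs; `s = -ρ`: drops at most `ρ` levels). -/
def Shifts (lvl : ι → ℤ) (s : ℤ) (X : Matrix ι ι ℂ) : Prop :=
  ∀ i j, X i j ≠ 0 → lvl j + s ≤ lvl i

omit [Fintype ι] in
theorem shifts_congr {lvl : ι → ℤ} {s t : ℤ} (h : s = t) {X : Matrix ι ι ℂ} (hX : Shifts lvl s X) :
    Shifts lvl t X := fun i j hij => by have := hX i j hij; omega

omit [Fintype ι] in
theorem shifts_mono {lvl : ι → ℤ} {s t : ℤ} (h : t ≤ s) {X : Matrix ι ι ℂ} (hX : Shifts lvl s X) :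
    Shifts lvl t X := fun i j hij => by have := hX i j hij; omega

omit [Fintype ι] in
theorem shifts_one (lvl : ι → ℤ) : Shifts lvl 0 (1 : Matrix ι ι ℂ) := by
  intro i j h
  by_cases hij : i = j
  · subst hij; simp
  · exact absurd (Matrix.one_apply_ne hij) h

omit [Fintype ι] in
theorem shifts_add {lvl : ι → ℤ} {s : ℤ} {X Y : Matrix ι ι ℂ} (hX : Shifts lvl s X) (hY : Shifts lvl s Y) :
    Shifts lvl s (X + Y) := by
  intro i j h
  rw [Matrix.add_apply] at h
  by_cases hx : X i j = 0
  · rw [hx, zero_add] at h; exact hY i j h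
  · exact hX i j hx

omit [Fintype ι] in
theorem shifts_smul {lvl : ι → ℤ} {s : ℤ} {X : Matrix ι ι ℂ} (c : ℂ) (hX : Shifts lvl s X) :
    Shifts lvl s (c • X) := by
  intro i j h
  rw [Matrix.smul_apply, smul_eq_mul] at h
  exact hX i j (right_ne_zero_of_mul h)

/-- Shifts ADD under products. -/
theorem shifts_mul {lvl : ι → ℤ} {s t : ℤ} {X Y : Matrix ι ι ℂ} (hX : Shifts lvl s X) (hY : Shifts lvl t Y) :
    Shifts lvl (s + t) (X * Y) := by
  intro i j h
  rw [Matrix.mul_apply] at h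
  obtain ⟨k, -, hk⟩ := Finset.exists_ne_zero_of_sum_ne_zero h
  have h1 := hX i k (left_ne_zero_of_mul hk)
  have h2 := hY k j (right_ne_zero_of_mul hk)
  omega

/-- **The word lemma, general ratio.**  If `P` drops at most `ρ` levels and `Q` climbs at least one, `gword P Q w` shifts levels
by at least `#Q − ρ·#P`. -/
theorem gword_shifts (ρ : ℕ) {lvl : ι → ℤ} {P Q : Matrix ι ι ℂ} (hP : Shifts lvl (-(ρ : ℤ)) P) (hQ : Shifts lvl 1 Q)
    (w : List Bool) : Shifts lvl ((w.count true : ℤ) - ρ * (w.count false : ℤ)) (gword P Q w) := by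
  induction w with
  | nil => simpa [gword] using shifts_one (ι := ι) lvl
  | cons b w ih =>
      have hcons : gword P Q (b :: w) = (if b then Q else P) * gword P Q w := by simp [gword]
      rw [hcons]
      cases b with
      | false =>
          simp only [Bool.false_eq_true, ↓reduceIte]
          refine shifts_congr ?_ (shifts_mul hP ih)
          simp
          ring
      | true =>
          simp only [↓reduceIte]
          refine shifts_congr ?_ (shifts_mul hQ ih)
          simp
          ring

omit [Fintype ι] in
/-- A matrix that shifts bounded levels by more than their range is zero. -/
theorem eq_zero_of_shifts {lvl : ι → ℤ} {L : ℕ} (hl : ∀ i, 0 ≤ lvl i ∧ lvl i ≤ L) {s : ℤ} {X : Matrix ι ι ℂ}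
    (hX : Shifts lvl s X) (hs : (L : ℤ) < s) : X = 0 := by
  ext i j
  by_contra h
  have h1 := hX i j h
  have h2 := hl i
  have h3 := hl j
  simp only [Matrix.zero_apply] at h
  omega

/-- ★ **Levels ⇒ ratio-speed.**  One level function with values in `[0, L]` along which every `P ∈ U` drops at most `ρ` levels
and every `Q ∈ T` climbs gives `RatioSpeed ρ L U T`.  (The `(r, c) = (ρ, 1)` weight certificate of `KrylovSeed.WeightThin`, in
word currency; e.g. the inflation `U_{p,k}` with its block flag: `ρ = p − 2`, `L = p − 1`, `T = J_p ⊗ M_k` of codimension `1`.) -/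
theorem ratioSpeed_of_shifts (ρ : ℕ) (lvl : ι → ℤ) (L : ℕ) (hl : ∀ i, 0 ≤ lvl i ∧ lvl i ≤ L) (U T : Set (Matrix ι ι ℂ))
    (hU : ∀ P ∈ U, Shifts lvl (-(ρ : ℤ)) P) (hT : ∀ Q ∈ T, Shifts lvl 1 Q) : RatioSpeed ρ L U T := by
  intro P hP Q hQ w hw
  by_contra hlt
  apply hw
  refine eq_zero_of_shifts hl (gword_shifts ρ (hU P hP) (hT Q hQ) w) ?_
  have : (L : ℤ) + ρ * (w.count false : ℤ) < (w.count true : ℤ) := by exact_mod_cast (not_le.mp hlt)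
  linarith

end Shifts

/-! ## §4 The residual uniform law and the wiring to R2 -/

/-- **`DenseRatioLaw`** (the residual format-free law; a CANDIDATE, not asserted).  For a linear space `U ⊆ M_d(ℂ)` of nilpotent
matrices of dimension `D` that is DENSE (`C·d² ≤ D·⌊√D⌋`, i.e. `D ≳ d^{4/3}` — the only regime in which a pencil top is not trivially
word-cheap) there are a ratio `ρ ≥ 1` and `T ≤ U` of codimension `≤ D/(4(ρ+1))` with `RatioSpeed ρ (⌊√D⌋/4) U T`.
Calibration (paper, `HALFSPEED-DEAD.md` §4): `𝔫_d` (`ρ = 1`, block flag, codim `≈ 2.3 d`), MOR cube-zero / `L_k` / `L′_k` (`ρ = 1`,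
codim `≤ 1`), inflations `U_{p,k}` (`ρ = p − 2`, codim `1`; density forces `k ≥ C p²` hence `Θ ≥ p − 1`), nested inflations, and the
direct sums `U_{p,k} ⊕ 𝔫_{d'}` that kill every all-heights / `C·d²`-budget normalisation.  The constants `(1/4, 1/4)` may be any
`(1/a, 1/b)` with `1/a + 1/b < 1` for K0″.  WHY IT MIGHT FAIL: a dense nilpotent «quasi-expander» — many independent deep returns at
every scale (the common risk of α's `FatBlockWeightLaw`). -/
def DenseRatioLaw : Prop :=
  ∃ C : ℕ, ∀ (d : ℕ) (U : Submodule ℂ (Matrix (Fin d) (Fin d) ℂ)), (∀ A ∈ U, IsNilpotent A) →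
    C * d ^ 2 ≤ Module.finrank ℂ U * Nat.sqrt (Module.finrank ℂ U) →
    ∃ (ρ : ℕ) (T : Submodule ℂ (Matrix (Fin d) (Fin d) ℂ)), 1 ≤ ρ ∧ T ≤ U ∧
      4 * (ρ + 1) * (Module.finrank ℂ U - Module.finrank ℂ T) ≤ Module.finrank ℂ U ∧
      RatioSpeed ρ (Nat.sqrt (Module.finrank ℂ U) / 4)
        (U : Set (Matrix (Fin d) (Fin d) ℂ)) (T : Set (Matrix (Fin d) (Fin d) ℂ))

/-- STUB K0″ (M — bookkeeping; port of ✓ p661921 `HalfSpeed.flagCostWordLaw_of_halfSpeedLaw`): `DenseRatioLaw → FlagCostWordLaw`.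
Recipe: `U := ℂ·N(0) ⊔ range T₀`; if `dim (range T₀) < n² − n` take `K := ker T₀` (`dim K > n`; every pair `(N x, 0)` is word-tame
with `(r, c, Θ) = (0, 1, 0)`, budget `0`); else `D := dim U ∈ [n² − n, n² + 1]`, the density hypothesis follows from `C₀ m² < n³`
(`C₀ := 4C + 64`, `n ≥ n₀` large), the law gives `ρ, T`; `K := T₀⁻¹ T` has `dim K ≥ n² − codim` (✓ `finrank_le_finrank_comap_add`);
close with `wordCheap_of_ratioSpeed`: `(1+ρ)·[(⌊(Θ + ρ(n−1))/(1+ρ)⌋ + 1)·n + codim] ≤ (Θ+1)·n + ρ·n² + (n²+1)/4 < (1+ρ)·n²` for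
`Θ = ⌊√D⌋/4 ≤ (n+1)/4`, `n ≥ 3`. -/
theorem stub_flagCostWordLaw_of_denseRatioLaw : DenseRatioLaw → FlagCostWordLaw := by
  sorry

/-- STUB LAW (research): the residual uniform law.  See the docstring of `DenseRatioLaw` and `HALFSPEED-DEAD.md` §4 for the
calibration it respects and the two refuted normalisations it replaces. -/
theorem stub_denseRatioLaw : DenseRatioLaw := by
  sorry

/-- HEAD: `DenseRatioLaw` ⇒ S3b-in-words ⇒ R2-in-words (✓ `heavyTopWordLaw_of_flagCostWordLaw`). -/
theorem heavyTopWordLaw_of_denseRatioLaw (h : DenseRatioLaw) : HeavyTopWordLaw :=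
  heavyTopWordLaw_of_flagCostWordLaw (stub_flagCostWordLaw_of_denseRatioLaw h)

/-- HEAD: `DenseRatioLaw` ⇒ R2 `HeavyTopLaw` BY NAME (Theorems-side `RadicalSplit.HeavyTopLaw`, ✓ `heavyTopLaw_iff_word`); with
`import …Cruxes.DualUnipotentThreeHalves.Lines.half_speed` one more line reaches the crux by name exactly as β's head
`dualUnipotentThreeHalves_of`. -/
theorem heavyTopLaw_of_denseRatioLaw (h : DenseRatioLaw) : HeavyTopLaw :=
  heavyTopLaw_iff_word.2 (heavyTopWordLaw_of_denseRatioLaw h)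

end Summit.ValiantsHypothesis.ValiantsHypothesis.Cruxes.DualUnipotentThreeHalves.RatioSpeed

end
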